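import Literature.MathematicalPhysics.QuantumFieldTheory.Balaban1983to89.T4PairDecorrelation

/-!
# `Balaban1983to89.T4TowerDecorrelation` — the LEVEL-RESOLVED («depth-weighted Schur») decorrelation budget for the
cube-family of co-read pair pieces: the located objection GAPS G-pv18g6-1 (i) to the level-blind clause
`T4PairDecorrelation.PairDecorrelation` (row T4-O3.E-ii-DECORR*) TYPED as a hypothesis shape, with its kernel
bookkeeping and its calibration (cell `pub-balaban`, T4-DAG v7 §5 row T4-O3.E-ii = node NE1(ii), self-proposed starred
sub-row T4-O3.E-ii-DECORR-LVL* of the pv18 lineage; a LEAF importing `T4PairDecorrelation` only; Mathlib + that module and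
`T4CoReadMoment` BY NAME; every declaration [folklore])

HONEST FRAMING (cell `pub-balaban`, T4-DAG PAGE 1).  The cell's T4 target is the existence AND uniqueness of the continuum
limit of Bałaban's unit-scale averaged loop expectations on a finite torus — a constructive-QFT statement strictly beyond
ultraviolet stability ([Balaban1989LargeFieldII] Thm 1 p. 355); it is NOT the Yang–Mills mass gap, NOT infinite volume and
NOT the Clay problem.  This module is kernel bookkeeping for ONE located objection to ONE located clause of ONE `EST` row
(T4-O3.E-ii, paper half `t4/T4-EST-O3Eii.md` §4 «NE1(ii)-DECORR», GAPS G-pv18g6-1 (i)).  It asserts NOTHING about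
Bałaban's papers: no estimate of the series B1–B16 is quoted as a fact, used or typed; neither the level-blind clause nor
the level-resolved clause below is estimated for Bałaban's conditional laws (both instances are OPEN and have no printed
locus for observable insertions, see LOCATED ITEMS).  Value = a typed hypothesis shape + kernel arithmetic (WHICH
decorrelation between pieces born at DIFFERENT levels of one tower the variance line can afford, with which constants, and
which it cannot); NOT summit progress, NOT the cell's estimate NE1′.

CITATION HEADER (lean-in-tree rule 2026-08-18).  This seat (pv18 lineage gen 7) re-read the RENDER
`b2b-balaban-ref1/pages/1988-cmp116-rg-II-cluster/1988-cmp116-rg-II-cluster-p021-x2.png` (journal p. 21 = PDF p. 21) of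
T. Bałaban, *Renormalization group approach to lattice gauge field theories. II. Cluster expansions*, Commun. Math. Phys.
**116** (1988) 1–22 [Balaban1988RG2Cluster] (cell paper B13), as an image, and quotes VERBATIM, for CONTEXT ONLY: p. 21
«extract the exponential exp(−δ½Lκd_{k+1}(Z_i)) from the i-th factor, and the remaining product is estimated using
(2.27), and the condition ∪Z_i = X, X is a connected domain. This yields» display (2.39):
|E^{(k+1)}(X)| ≤ exp(−(1 − 9δ)½Lκd_{k+1}(X)) exp(−5κ) · Σ_{n=1}^{∞} (1/n!) Σ_{(Z_1,…,Z_n): ∪Z_i = X} |ρ^T(Z_1, …, Z_n)|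
Π_{i=1}^{n} C₃ε₁ exp 5κ exp(−δ½Lκd_{k+1}(Z_i)) — i.e. the truncated functions |ρ^T| are summed against the ACTIVITY BOUNDS
(2.38) (the activities H(Z_i) already replaced by C₃ε₁e^{5κ}e^{−δ½Lκd_{k+1}(Z_i)}; this corrects the paraphrase «times the
activities» of `T4PairDecorrelation`'s header, XREAD nit C-pv28g5-9) — and «To the above sum we can repeat all the
considerations and bounds of the paper [26], for κ sufficiently large, and ε₁ sufficiently small. We obtain» (2.40).  WHY
THIS LINE: it is the printed place where connected parts of the scale-`k` expansion are summed against per-domain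
exponential weights — the MECHANISM from which ANY decorrelation kernel between pair pieces would come.  It concerns the
activities of ONE expansion step; correlations between pieces BORN AT DIFFERENT STEPS of one tower (the subject of this
module) are a property of the COMPOSITION of the conditional laws along the tower and are printed NOWHERE (negative finding
of `t4/T4-EST-O3Eii.md` §1 stands; GAPS G-pv18g6-1).  No disputed step of the manuscripts is used; the quotation only
LOCATES the clause.  Every `theorem` below is [folklore] (finite sums, geometric series, `Real.sqrt`, and the measure-side
lemmas of `T4PairDecorrelation` / `T4CoReadMoment` imported BY NAME).

THE OBJECTION SERVED (cell text, verbatim excerpt; CELL ANALYSIS, located, NOT a fact).  GAPS G-pv18g6-1 «Why the instance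
might FAIL as hoped [analysis]: (i) the pieces ℓ[B_p] of one cube are functions of OVERLAPPING sets of fine bond variables
whenever their towers share bonds below the cube scale (that is what «co-read» means), so κ(p,q) for tower-sharing p, q is
O(1), not small — the budget must come from the NUMBER of partners sharing a tower with p at depth m (≍ Λ^m) against the
depth suppression of such pieces' sizes, i.e. C_dec is really a weighted Schur budget and the weights are the (τ²)^{K−lvl}
profile of K11a, not a pure distance kernel».  THIS MODULE TYPES (i): the level-blind Schur budget `Σ_q κ(p,q) ≤ C` of
(K12c) is replaced by LEVEL-RESOLVED row sums — for every piece `p` and every GAP `g`, the kernel mass of `p` on the pieces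
born `g` levels BELOW it is `≤ B·(Λν)^g` (`Λ^g` = the growth of the number of such partners, `ν^g` = the decay of the
correlation per level of gap, `B` = the same-gap budget) — and the AMPLITUDE PROFILE `|a_p| ≤ M·τ^{K − lvl p}` of the
variance line (K11a) is what pays for the growth.

DICTIONARY.  As `T4PairDecorrelation` (K12c): `μ` = a law on `Ω` (cell: the conditional law of the scale-`k` fluctuation
field at a fixed exterior), `s` = the pair pieces alive in one cube, `X p` = the centred piece without amplitude, `c p` its
amplitude, `σ p` a second-moment scale, `κ p q` the decorrelation kernel; NEW: `lvl p ≤ k` = the birth level of the piece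
(level `k` = the cube's own, coarsest; level `0` the finest), `K` = the number of steps, `Λ` = pieces-per-level growth
(cell `L⁴`), `τ` = first-order rate per level (cell `θ₁ = L⁻³`), `ν` = CORRELATION DECAY PER LEVEL OF GAP between a piece and
the pieces nested below it (the NEW currency of this module), `B` = same-gap row budget, `r ≥ Λτ²` and `ρ ≥ Λντ` the two
STRICT products.

WHAT IS TYPED AND PROVED (all [folklore]; `lean check` rc 0, 0 sorry; standard axioms).
* §1 (K13a) `downSum_le`: pieces with `lvl p ≤ k ≤ K`, amplitudes `|a_p| ≤ Mτ^{K−lvl p}`, counts `#{lvl = j} ≤ N₀Λ^{k−j}`, a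
  kernel `κ ≥ 0` with DOWNWARD level-resolved row sums `Σ_{q : lvl q + g = lvl p} κ(p,q) ≤ B(Λν)^g`, and `Λτ² ≤ r < 1`,
  `Λντ ≤ ρ < 1`, `0 ≤ τ ≤ 1` give `Σ_p Σ_{q : lvl q ≤ lvl p} κ(p,q)|a_p||a_q| ≤ N₀M²B/((1−ρ)(1−r))` (for fixed `p` at level
  `j`: `Σ_{g ≤ j} B(Λν)^g·Mτ^{K−j+g}`, × `|a_p| ≤ Mτ^{K−j}`, = `M²B(τ²)^{K−j}Σ_g(Λντ)^g` — `T4PairDecorrelation.shellSum_le_of_geom`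
  BY NAME with shells := gaps — then `T4PairDecorrelation.cubeBudget_le` = K11a BY NAME over `p`).  (K13b) MAIN
  `levelledSum_le`: with the same hypothesis for the TRANSPOSED kernel, the FULL double sum
  `Σ_{p,q ∈ s} κ(p,q)|a_p||a_q| ≤ 2·N₀M²B/((1−ρ)(1−r))` — the pairs with `lvl q > lvl p` are the downward pairs of `κᵀ`
  (`sum_comm'`); UPWARD row sums are never needed.  (K13b′) `levelledSum_le_of_sq`: the same from SQUARED budgets
  `a_p² ≤ A(τ²)^{K−lvl p}` (the `hw` of K12g′), `M² ↦ A`.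
* §2 SUPPLIERS of the level-resolved row sums (arithmetic): (K13c) `sliceSum_le_of_partners` — if on the gap-`g` slice the
  kernel vanishes off a PARTNER relation (cell: «sharing a tower with p»), is `≤ A_κν^g` on partners, and `p` has at most
  `G₀Λ^g` partners at gap `g`, the slice sum is `≤ A_κG₀(Λν)^g` — G-pv18g6-1 (i)'s «NUMBER of partners … (≍ Λ^m) against …»
  verbatim; (K13d) `sliceSum_le_of_treeDecay` — partners need not be exact: `κ ≤ A_κν^gθ^{dist}` on the slice with slice
  shell counts `≤ G₀Λ^gΓⁿ` and `Γθ ≤ ρ′ < 1` gives `≤ (A_κG₀/(1−ρ′))(Λν)^g` (`T4PairDecorrelation.rowSum_le_of_treeDecay` BY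
  NAME on the slice: separation decay WITHIN a gap and gap decay ACROSS gaps compose).
* §3 (K13e) THE SHAPE `TowerDecorrelation μ s X σ κ lvl B Λ ν` (a `structure … : Prop`): `σ ≥ 0`, `κ ≥ 0` on `s`, covariance
  domination `|∫X_pX_q dμ| ≤ κ(p,q)σ_pσ_q` (as K12c), and the level-resolved row sums for `κ` AND `κᵀ`; `of_symm`;
  (K13f) `of_pairDecorrelation`: the level-blind shape (K12c) with budget `C` IS the case `B = C`, `ν = Λ⁻¹` (`Λν = 1`: no
  decay per gap claimed, none needed beyond `τ < 1`) — K5 ⊂ K6; (K13g) `integral_sq_sum_le_line`: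
  `∫(Σ_p c_pX_p)² dμ ≤ 2N₀AB/((1−ρ)(1−r))` under `(c_pσ_p)² ≤ A(τ²)^{K−lvl p}` and the counts; (K13h)
  `log_integral_exp_neg_sum_le_line`: for bounded measurable CENTRED pieces with `Σ|c_p|b_p ≤ 1`,
  `0 ≤ log∫exp(−Σ_p c_pX_p) dμ ≤ 2N₀AB/((1−ρ)(1−r))` — K-UNIFORM (`T4CoReadMoment` (K10) BY NAME via
  `T4PairDecorrelation.integrable_mul_of_abs_le`).
* §4 CALIBRATION — WHICH `ν` THE VARIANCE LINE AFFORDS (arithmetic on the attained line `towerLine`, the up-part of the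
  double sum for the Λ-ary TREE MODEL: one piece per node, `κ = ν^{gap}` on nested pairs, amplitudes `= Mτ^{K−lvl}`):
  (K13i) `towerLine_ge` / `towerLine_top_ge`: with `ν = 1` (O(1) correlations between a piece and EVERY piece nested in it,
  the literal reading of «κ(p,q) for tower-sharing p, q is O(1)») and `Λτ ≥ 1` the line is `≥ (k+1)·N₀M²B·τ^{2(K−k)}`, at the
  top cube `≥ (K+1)·N₀M²B` — UNBOUNDED in `K`: O(1) co-tower correlations are NOT affordable at the cell's values `Λτ = L`
  (`T4CoReadMoment.supLine_ge`'s mechanism one level up: per gap `g` the `Λ^g` nested partners beat the `τ^g` amplitude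
  suppression); (K13j) `threshold_iff`: `Λντ < 1 ↔ ν < 1/(Λτ)` — the cell's THRESHOLD `ν < 1/(L⁴·L⁻³) = L⁻¹` per level of
  gap; (K13k) `sqrt_mul_lt_one_iff`: the CLT-size decay `ν = Λ^{−1/2}` (a piece nested `g` levels up sees the finer piece as
  one of `≍ Λ^g` comparable contributions) needs `√Λ·τ < 1 ↔ Λτ² < 1` — NO condition beyond the variance line's own; (K13l)
  `cellValues_L2_tower` / `_L3_tower` / `cellValues_tower`: at `Λ = L⁴`, `τ = L⁻³`: `Λ·1·τ = L ≥ 1` (fails),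
  `Λ·L⁻²·τ = L⁻¹ < 1` (CLT passes), `Λ·Λ⁻¹·τ = L⁻³ < 1` (level-blind passes).

READINGS (analysis on the typed shapes; CELL ANALYSIS where it speaks of the cell).  (1) G-pv18g6-1 (i) is CONFIRMED AND
QUANTIFIED in kernel: a level-blind `C_dec` independent of `#s` cannot come from a pure distance kernel when nested pieces
are O(1)-correlated, and the variance line does NOT rescue O(1) nested correlations either (K13i); what it DOES afford is any
per-gap decay `ν < 1/(Λθ₁) = L⁻¹` (K13j), in particular the CLT-size `ν = L⁻²` with room `L⁻¹` per gap (K13k/l).  So the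
instance the cell needs (OPEN, analysis) is: «the conditional covariance of a co-read pair piece born at level `j` with the
pieces born at level `j − g` INSIDE its block is `≤ A_κν^g·σ_pσ_q` with `ν·L⁴·L⁻³ < 1`, uniformly in the exterior and in
`K`», plus the same-gap separation decay of (K12h) — sharper than G-pv18g6-1's wording and weaker than level-blind
summability.  (2) Only DOWNWARD slices are hypothesised (for `κ` and `κᵀ`); for a symmetric kernel the upward row sum at
gap `g` is then automatically `≤ B·ν^g·(#partners above = O(1))`-shaped, but the theorem never uses it: the transpose trick
(K13b) books each unordered pair from its COARSER end, where the count growth `Λ^g` and the amplitude gain `τ^g` of the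
finer partner meet in the single product `Λντ`.  (3) The factor `2` double-books the diagonal slice `g = 0`; immaterial.
(4) (K13f) shows the level-blind clause is the `ν = Λ⁻¹` corner of the levelled one, so every consumer of K5's headline
(K12g′) can take (K13h) instead with `(B, ν) = (C_dec, Λ⁻¹)` and the extra harmless condition `τ ≤ ρ < 1`.  (5) As in
K5, centring and `Σ|c_p|b_p ≤ 1` are (K10)'s hypotheses verbatim; the conditional-mean budget off a flat exterior
(NE1(ii)-MEAN / O-G7, G-pv18g6-1 (ii)) enters `σ_p`, not `κ`, and is not touched.

LOCATED ITEMS NOT TOUCHED (cell obligations; none printed, none kernel): the INSTANCE of `TowerDecorrelation` for Bałaban's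
conditional fluctuation laws — a per-gap decay `ν` with `L⁴ν·θ₁ < 1` of the conditional covariance between nested co-read
pair pieces, uniformly in the exterior and `K` (= G-pv18g6-1 SHARPENED; loci: the composition of the one-step conditional
laws along a tower, B13 §2 S4/S5 with two insertions; not in print); the same-gap separation decay (K12h) instance; the
conditional-mean budget O-G7; the pair shape `LoopPairOscBoundSep` and its one-step laws (row NE1ii-BIRTH); the multi-step
polymer format (rows O3.E-iii-a/b/c); `s`-body pieces, `s ≥ 3`.
-/

noncomputable section

open MeasureTheory Finset
open scoped BigOperators

namespace Literature.MathematicalPhysics.QuantumFieldTheory.Balaban1983to89.T4TowerDecorrelation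

open Literature.MathematicalPhysics.QuantumFieldTheory.Balaban1983to89.T4CoReadMoment
open Literature.MathematicalPhysics.QuantumFieldTheory.Balaban1983to89.T4PairDecorrelation

/-! ## §1 (K13a–b) The levelled double sum -/

section Levels

variable {ι : Type*}

/-- (K13a₀) On the gap-`g` slice below a piece `p` of level `≤ K`, the amplitude profile factors:
`K − lvl q = (K − lvl p) + g`, so `|a_q| ≤ M·τ^{K − lvl p}·τ^g`. [folklore] -/
theorem abs_le_of_slice {s : Finset ι} (lvl : ι → ℕ) (a : ι → ℝ) {M τ : ℝ} {K : ℕ} {p q : ι} {g : ℕ}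
    (hpK : lvl p ≤ K) (hq : q ∈ s.filter fun q => lvl q + g = lvl p)
    (ha : ∀ q ∈ s, |a q| ≤ M * τ ^ (K - lvl q)) :
    |a q| ≤ M * τ ^ (K - lvl p) * τ ^ g := by
  obtain ⟨hqs, hqg⟩ := mem_filter.mp hq
  have e : K - lvl q = (K - lvl p) + g := by omega
  calc |a q| ≤ M * τ ^ (K - lvl q) := ha q hqs
    _ = M * τ ^ (K - lvl p) * τ ^ g := by rw [e, pow_add, mul_assoc]

/-- (K13a₁) THE DOWNWARD SLICE SUM AT ONE PIECE: if the kernel mass of `p` on the pieces `g` levels below it is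
`≤ B(Λν)^g` for every gap `g`, the amplitudes follow the profile `|a_q| ≤ Mτ^{K − lvl q}` and `Λντ ≤ ρ < 1`, then
`Σ_{q ∈ s, lvl q ≤ lvl p} κ(p,q)|a_q| ≤ Mτ^{K − lvl p}·B/(1−ρ)` — the gaps are the shells of
`T4PairDecorrelation.shellSum_le_of_geom` (growth `Λν`, decay `τ`). [folklore] -/
theorem sliceDownSum_le {s : Finset ι} (lvl : ι → ℕ) (κ : ι → ι → ℝ) (a : ι → ℝ) {M B Λ ν τ ρ : ℝ} {K : ℕ}
    {p : ι} (hp : p ∈ s) (hpK : lvl p ≤ K) (hM : 0 ≤ M) (hB : 0 ≤ B) (hΛ : 0 ≤ Λ) (hν : 0 ≤ ν) (hτ0 : 0 ≤ τ)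
    (hρ : Λ * ν * τ ≤ ρ) (hρ1 : ρ < 1) (hκ : ∀ p ∈ s, ∀ q ∈ s, 0 ≤ κ p q)
    (hdown : ∀ g : ℕ, ∑ q ∈ s.filter (fun q => lvl q + g = lvl p), κ p q ≤ B * (Λ * ν) ^ g)
    (ha : ∀ q ∈ s, |a q| ≤ M * τ ^ (K - lvl q)) :
    ∑ q ∈ s.filter (fun q => lvl q ≤ lvl p), κ p q * |a q| ≤ M * τ ^ (K - lvl p) * (B / (1 - ρ)) := by
  have hmaps : ∀ q ∈ s.filter (fun q => lvl q ≤ lvl p), lvl p - lvl q ∈ range (lvl p + 1) :=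
    fun q _ => mem_range.mpr (by omega)
  rw [← sum_fiberwise_of_maps_to hmaps]
  have hfib : ∀ g, (s.filter fun q => lvl q ≤ lvl p).filter (fun q => lvl p - lvl q = g) =
      s.filter (fun q => lvl q + g = lvl p) := by
    intro g
    rw [filter_filter]
    exact filter_congr fun q _ => by omega
  simp only [hfib]
  calc ∑ g ∈ range (lvl p + 1), ∑ q ∈ s.filter (fun q => lvl q + g = lvl p), κ p q * |a q|
      ≤ ∑ g ∈ range (lvl p + 1),
          (∑ q ∈ s.filter (fun q => lvl q + g = lvl p), κ p q) * (M * τ ^ (K - lvl p) * τ ^ g) := by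
        refine sum_le_sum fun g _ => ?_
        rw [sum_mul]
        refine sum_le_sum fun q hq => ?_
        exact mul_le_mul_of_nonneg_left (abs_le_of_slice lvl a hpK hq ha) (hκ p hp q (mem_filter.mp hq).1)
    _ = M * τ ^ (K - lvl p) *
          ∑ g ∈ range (lvl p + 1), (∑ q ∈ s.filter (fun q => lvl q + g = lvl p), κ p q) * τ ^ g := by
        rw [mul_sum]
        exact sum_congr rfl fun g _ => by ring
    _ ≤ M * τ ^ (K - lvl p) * (B / (1 - ρ)) :=
        mul_le_mul_of_nonneg_left
          (shellSum_le_of_geom (G := fun g => ∑ q ∈ s.filter (fun q => lvl q + g = lvl p), κ p q) (lvl p) hB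
            (mul_nonneg hΛ hν) hτ0 (fun g _ => hdown g) hρ hρ1)
          (mul_nonneg hM (pow_nonneg hτ0 _))

/-- **(K13a) THE DOWNWARD HALF OF THE LEVELLED DOUBLE SUM.**  Pieces `p ∈ s` with birth levels `lvl p ≤ k ≤ K`, amplitudes
`|a_p| ≤ Mτ^{K − lvl p}` (`M ≥ 0`, `0 ≤ τ ≤ 1`), positional counts `#{p : lvl p = j} ≤ N₀Λ^{k−j}`, a kernel `κ ≥ 0` whose
DOWNWARD level-resolved row sums obey `Σ_{q : lvl q + g = lvl p} κ(p,q) ≤ B(Λν)^g` for all `p`, `g`, and the two strict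
products `Λτ² ≤ r < 1`, `Λντ ≤ ρ < 1`: then `Σ_p Σ_{q : lvl q ≤ lvl p} κ(p,q)|a_p||a_q| ≤ N₀·(M²B/(1−ρ))/(1−r)`, uniformly
in `k`, `K`, `#s`.  ((K13a₁) per piece gives the per-piece budget `(M²B/(1−ρ))·(τ²)^{K − lvl p}`, then
`T4PairDecorrelation.cubeBudget_le` = the variance line K11a BY NAME.) [folklore] -/
theorem downSum_le {s : Finset ι} (lvl : ι → ℕ) (κ : ι → ι → ℝ) (a : ι → ℝ) {N₀ M B Λ ν τ r ρ : ℝ} {K k : ℕ}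
    (hk : k ≤ K) (hlvl : ∀ p ∈ s, lvl p ≤ k)
    (hcard : ∀ j, j ≤ k → ((s.filter fun p => lvl p = j).card : ℝ) ≤ N₀ * Λ ^ (k - j))
    (hN₀ : 0 ≤ N₀) (hM : 0 ≤ M) (hB : 0 ≤ B) (hΛ : 0 ≤ Λ) (hν : 0 ≤ ν) (hτ0 : 0 ≤ τ) (hτ1 : τ ≤ 1)
    (hr : Λ * τ ^ 2 ≤ r) (hr1 : r < 1) (hρ : Λ * ν * τ ≤ ρ) (hρ1 : ρ < 1)
    (hκ : ∀ p ∈ s, ∀ q ∈ s, 0 ≤ κ p q)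
    (hdown : ∀ p ∈ s, ∀ g : ℕ, ∑ q ∈ s.filter (fun q => lvl q + g = lvl p), κ p q ≤ B * (Λ * ν) ^ g)
    (ha : ∀ p ∈ s, |a p| ≤ M * τ ^ (K - lvl p)) :
    ∑ p ∈ s, ∑ q ∈ s.filter (fun q => lvl q ≤ lvl p), κ p q * (|a p| * |a q|) ≤
      N₀ * (M ^ 2 * (B / (1 - ρ))) / (1 - r) := by
  have hρ0 : 0 < 1 - ρ := by linarith
  have hA : 0 ≤ M ^ 2 * (B / (1 - ρ)) := mul_nonneg (sq_nonneg M) (div_nonneg hB hρ0.le)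
  refine cubeBudget_le lvl hk hlvl hcard hN₀ hA hΛ hτ0 hτ1 hr hr1
    (w := fun p => ∑ q ∈ s.filter (fun q => lvl q ≤ lvl p), κ p q * (|a p| * |a q|)) fun p hp => ?_
  have hpK : lvl p ≤ K := (hlvl p hp).trans hk
  have hslice := sliceDownSum_le lvl κ a hp hpK hM hB hΛ hν hτ0 hρ hρ1 hκ (hdown p hp) ha
  have hnn : 0 ≤ ∑ q ∈ s.filter (fun q => lvl q ≤ lvl p), κ p q * |a q| :=
    sum_nonneg fun q hq => mul_nonneg (hκ p hp q (mem_filter.mp hq).1) (abs_nonneg _)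
  calc ∑ q ∈ s.filter (fun q => lvl q ≤ lvl p), κ p q * (|a p| * |a q|)
      = |a p| * ∑ q ∈ s.filter (fun q => lvl q ≤ lvl p), κ p q * |a q| := by
        rw [mul_sum]
        exact sum_congr rfl fun q _ => by ring
    _ ≤ (M * τ ^ (K - lvl p)) * (M * τ ^ (K - lvl p) * (B / (1 - ρ))) :=
        mul_le_mul (ha p hp) hslice hnn (mul_nonneg hM (pow_nonneg hτ0 _))
    _ = M ^ 2 * (B / (1 - ρ)) * (τ ^ (K - lvl p)) ^ 2 := by ring
    _ = M ^ 2 * (B / (1 - ρ)) * (τ ^ 2) ^ (K - lvl p) := by rw [pow_right_comm]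

/-- (K13b₀) SPLITTING THE DOUBLE SUM AT THE DIAGONAL OF LEVELS: every ordered pair `(p, q)` has `lvl q ≤ lvl p` or
`lvl p < lvl q`, and the second family, summed `q`-first, is a family of downward pairs for the transposed kernel.
[folklore] -/
theorem sum_sum_eq_down_add_up (s : Finset ι) (lvl : ι → ℕ) (F : ι → ι → ℝ) :
    ∑ p ∈ s, ∑ q ∈ s, F p q =
      (∑ p ∈ s, ∑ q ∈ s.filter (fun q => lvl q ≤ lvl p), F p q) +
        ∑ q ∈ s, ∑ p ∈ s.filter (fun p => lvl p < lvl q), F p q := by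
  have hcomm : ∑ q ∈ s, ∑ p ∈ s.filter (fun p => lvl p < lvl q), F p q =
      ∑ p ∈ s, ∑ q ∈ s.filter (fun q => lvl p < lvl q), F p q :=
    sum_comm' fun q p => by
      simp only [mem_filter]
      tauto
  rw [hcomm, ← sum_add_distrib]
  refine sum_congr rfl fun p _ => ?_
  rw [← sum_filter_add_sum_filter_not s (fun q => lvl q ≤ lvl p) (fun q => F p q)]
  congr 1
  exact sum_congr (filter_congr fun q _ => not_le) fun _ _ => rfl

/-- **(K13b) MAIN — THE LEVELLED («depth-weighted Schur») BUDGET.**  Under the hypotheses of (K13a) for the kernel AND for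
its transpose (`Σ_{q : lvl q + g = lvl p} κ(q,p) ≤ B(Λν)^g`; for a symmetric kernel the same clause), the FULL double sum
obeys `Σ_{p,q ∈ s} κ(p,q)|a_p||a_q| ≤ 2·N₀·(M²B/(1−ρ))/(1−r)` — uniformly in `k`, `K` and `#s`.  Each unordered pair is
booked from its COARSER end; upward row sums are never used.  With `ν = Λ⁻¹` this is the level-blind Schur budget of
(K12a) up to the factor `2/(1−τ)`; its CONTENT is `ν > Λ⁻¹`: correlations with the `Λ^g`-many pieces nested `g` levels
down may decay as slowly as `ν^g` with `Λντ < 1` (cell: `ν < L⁻¹`), where level-blind summability would need `(Λν)^g`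
summable. [folklore] -/
theorem levelledSum_le {s : Finset ι} (lvl : ι → ℕ) (κ : ι → ι → ℝ) (a : ι → ℝ) {N₀ M B Λ ν τ r ρ : ℝ} {K k : ℕ}
    (hk : k ≤ K) (hlvl : ∀ p ∈ s, lvl p ≤ k)
    (hcard : ∀ j, j ≤ k → ((s.filter fun p => lvl p = j).card : ℝ) ≤ N₀ * Λ ^ (k - j))
    (hN₀ : 0 ≤ N₀) (hM : 0 ≤ M) (hB : 0 ≤ B) (hΛ : 0 ≤ Λ) (hν : 0 ≤ ν) (hτ0 : 0 ≤ τ) (hτ1 : τ ≤ 1)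
    (hr : Λ * τ ^ 2 ≤ r) (hr1 : r < 1) (hρ : Λ * ν * τ ≤ ρ) (hρ1 : ρ < 1)
    (hκ : ∀ p ∈ s, ∀ q ∈ s, 0 ≤ κ p q)
    (hdown : ∀ p ∈ s, ∀ g : ℕ, ∑ q ∈ s.filter (fun q => lvl q + g = lvl p), κ p q ≤ B * (Λ * ν) ^ g)
    (hdownT : ∀ p ∈ s, ∀ g : ℕ, ∑ q ∈ s.filter (fun q => lvl q + g = lvl p), κ q p ≤ B * (Λ * ν) ^ g)
    (ha : ∀ p ∈ s, |a p| ≤ M * τ ^ (K - lvl p)) :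
    ∑ p ∈ s, ∑ q ∈ s, κ p q * (|a p| * |a q|) ≤ 2 * (N₀ * (M ^ 2 * (B / (1 - ρ))) / (1 - r)) := by
  have h1 := downSum_le lvl κ a hk hlvl hcard hN₀ hM hB hΛ hν hτ0 hτ1 hr hr1 hρ hρ1 hκ hdown ha
  have h2 : ∑ q ∈ s, ∑ p ∈ s.filter (fun p => lvl p < lvl q), κ p q * (|a p| * |a q|) ≤
      N₀ * (M ^ 2 * (B / (1 - ρ))) / (1 - r) := by
    calc ∑ q ∈ s, ∑ p ∈ s.filter (fun p => lvl p < lvl q), κ p q * (|a p| * |a q|)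
        ≤ ∑ q ∈ s, ∑ p ∈ s.filter (fun p => lvl p ≤ lvl q), (fun p' q' => κ q' p') q p * (|a q| * |a p|) := by
          refine sum_le_sum fun q hq => ?_
          calc ∑ p ∈ s.filter (fun p => lvl p < lvl q), κ p q * (|a p| * |a q|)
              ≤ ∑ p ∈ s.filter (fun p => lvl p ≤ lvl q), κ p q * (|a p| * |a q|) :=
                sum_le_sum_of_subset_of_nonneg
                  (fun p hp => by
                    obtain ⟨hps, hlt⟩ := mem_filter.mp hp
                    exact mem_filter.mpr ⟨hps, hlt.le⟩)
                  fun p hp _ =>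
                    mul_nonneg (hκ p (mem_filter.mp hp).1 q hq) (mul_nonneg (abs_nonneg _) (abs_nonneg _))
            _ = ∑ p ∈ s.filter (fun p => lvl p ≤ lvl q), (fun p' q' => κ q' p') q p * (|a q| * |a p|) :=
                sum_congr rfl fun p _ => by ring
      _ ≤ N₀ * (M ^ 2 * (B / (1 - ρ))) / (1 - r) :=
          downSum_le lvl (fun p' q' => κ q' p') a hk hlvl hcard hN₀ hM hB hΛ hν hτ0 hτ1 hr hr1 hρ hρ1
            (fun p hp q hq => hκ q hq p hp) hdownT ha
  rw [sum_sum_eq_down_add_up s lvl, two_mul]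
  exact add_le_add h1 h2

/-- (K13b′₀) Square-root reading of a squared budget: `a² ≤ A(τ²)ⁿ` with `A, τ ≥ 0` gives `|a| ≤ √A·τⁿ`. [folklore] -/
theorem abs_le_sqrt_mul_pow {a A τ : ℝ} {n : ℕ} (hA : 0 ≤ A) (hτ0 : 0 ≤ τ) (h : a ^ 2 ≤ A * (τ ^ 2) ^ n) :
    |a| ≤ Real.sqrt A * τ ^ n := by
  have h2 : Real.sqrt (A * (τ ^ 2) ^ n) = Real.sqrt A * τ ^ n := by
    rw [Real.sqrt_mul hA, ← pow_mul, mul_comm 2 n, pow_mul, Real.sqrt_sq (pow_nonneg hτ0 _)]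
  rw [← Real.sqrt_sq_eq_abs, ← h2]
  exact Real.sqrt_le_sqrt h

/-- **(K13b′) THE LEVELLED BUDGET FROM SQUARED PER-PIECE BUDGETS** (the `hw` of K12g′): `a_p² ≤ A(τ²)^{K − lvl p}` in place
of `|a_p| ≤ Mτ^{K − lvl p}` gives `Σ_{p,q} κ(p,q)|a_p||a_q| ≤ 2·N₀·(AB/(1−ρ))/(1−r)`. [folklore] -/
theorem levelledSum_le_of_sq {s : Finset ι} (lvl : ι → ℕ) (κ : ι → ι → ℝ) (a : ι → ℝ) {N₀ A B Λ ν τ r ρ : ℝ}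
    {K k : ℕ} (hk : k ≤ K) (hlvl : ∀ p ∈ s, lvl p ≤ k)
    (hcard : ∀ j, j ≤ k → ((s.filter fun p => lvl p = j).card : ℝ) ≤ N₀ * Λ ^ (k - j))
    (hN₀ : 0 ≤ N₀) (hA : 0 ≤ A) (hB : 0 ≤ B) (hΛ : 0 ≤ Λ) (hν : 0 ≤ ν) (hτ0 : 0 ≤ τ) (hτ1 : τ ≤ 1)
    (hr : Λ * τ ^ 2 ≤ r) (hr1 : r < 1) (hρ : Λ * ν * τ ≤ ρ) (hρ1 : ρ < 1)
    (hκ : ∀ p ∈ s, ∀ q ∈ s, 0 ≤ κ p q)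
    (hdown : ∀ p ∈ s, ∀ g : ℕ, ∑ q ∈ s.filter (fun q => lvl q + g = lvl p), κ p q ≤ B * (Λ * ν) ^ g)
    (hdownT : ∀ p ∈ s, ∀ g : ℕ, ∑ q ∈ s.filter (fun q => lvl q + g = lvl p), κ q p ≤ B * (Λ * ν) ^ g)
    (hw : ∀ p ∈ s, (a p) ^ 2 ≤ A * (τ ^ 2) ^ (K - lvl p)) :
    ∑ p ∈ s, ∑ q ∈ s, κ p q * (|a p| * |a q|) ≤ 2 * (N₀ * (A * (B / (1 - ρ))) / (1 - r)) := by
  have h := levelledSum_le lvl κ a hk hlvl hcard hN₀ (Real.sqrt_nonneg A) hB hΛ hν hτ0 hτ1 hr hr1 hρ hρ1 hκ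
    hdown hdownT fun p hp => abs_le_sqrt_mul_pow hA hτ0 (hw p hp)
  rwa [Real.sq_sqrt hA] at h

end Levels

/-! ## §2 (K13c–d) Suppliers of the level-resolved row sums -/

section Suppliers

variable {ι : Type*}

/-- **(K13c) PARTNER COUNT × PER-GAP DECAY** (G-pv18g6-1 (i) verbatim: «the budget must come from the NUMBER of partners
sharing a tower with p at depth m (≍ Λ^m) against …»).  On the gap-`g` slice below `p`, let the kernel VANISH off a partner
relation `rel p ·` (cell: the piece `q` is born inside `p`'s block / shares its tower), be `≤ A_κν^g` on partners, and let
`p` have at most `G₀Λ^g` partners on the slice: then the slice sum is `≤ (A_κG₀)·(Λν)^g`. [folklore] -/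
theorem sliceSum_le_of_partners {s : Finset ι} (lvl : ι → ℕ) (κ : ι → ι → ℝ) (rel : ι → ι → Prop) (p : ι)
    [DecidablePred (rel p)] {Aκ G₀ Λ ν : ℝ} (g : ℕ) (hAκ : 0 ≤ Aκ) (hν : 0 ≤ ν)
    (hzero : ∀ q ∈ s, lvl q + g = lvl p → ¬ rel p q → κ p q ≤ 0)
    (hκ : ∀ q ∈ s, lvl q + g = lvl p → rel p q → κ p q ≤ Aκ * ν ^ g)
    (hcount : (((s.filter fun q => lvl q + g = lvl p).filter (rel p)).card : ℝ) ≤ G₀ * Λ ^ g) :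
    ∑ q ∈ s.filter (fun q => lvl q + g = lvl p), κ p q ≤ Aκ * G₀ * (Λ * ν) ^ g := by
  set t := s.filter (fun q => lvl q + g = lvl p) with ht
  rw [← sum_filter_add_sum_filter_not t (rel p) (κ p)]
  have h1 : ∑ q ∈ t.filter (rel p), κ p q ≤ ((t.filter (rel p)).card : ℝ) * (Aκ * ν ^ g) := by
    have := sum_le_sum (s := t.filter (rel p)) (f := κ p) (g := fun _ => Aκ * ν ^ g) fun q hq => by
      obtain ⟨hqt, hqr⟩ := mem_filter.mp hq
      obtain ⟨hqs, hqg⟩ := mem_filter.mp hqt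
      exact hκ q hqs hqg hqr
    rwa [sum_const, nsmul_eq_mul] at this
  have h2 : ∑ q ∈ t.filter (fun q => ¬ rel p q), κ p q ≤ 0 :=
    sum_nonpos fun q hq => by
      obtain ⟨hqt, hqr⟩ := mem_filter.mp hq
      obtain ⟨hqs, hqg⟩ := mem_filter.mp hqt
      exact hzero q hqs hqg hqr
  have h3 : ((t.filter (rel p)).card : ℝ) * (Aκ * ν ^ g) ≤ G₀ * Λ ^ g * (Aκ * ν ^ g) :=
    mul_le_mul_of_nonneg_right hcount (mul_nonneg hAκ (pow_nonneg hν g))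
  calc ∑ q ∈ t.filter (rel p), κ p q + ∑ q ∈ t.filter (fun q => ¬ rel p q), κ p q
      ≤ G₀ * Λ ^ g * (Aκ * ν ^ g) + 0 := add_le_add (h1.trans h3) h2
    _ = Aκ * G₀ * (Λ * ν) ^ g := by rw [mul_pow]; ring

/-- **(K13d) SEPARATION DECAY WITHIN A GAP × DECAY ACROSS GAPS.**  On the gap-`g` slice below `p`, a kernel dominated by
`A_κ·ν^g·θ^{dist p q}`, slice shell counts `#{q on the slice : dist p q = n} ≤ (G₀Λ^g)·Γⁿ` within the range `D`, and
`Γθ ≤ ρ′ < 1` give the slice sum `≤ (A_κ·G₀/(1−ρ′))·(Λν)^g` — `T4PairDecorrelation.rowSum_le_of_treeDecay` (K12h″) BY NAME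
on the slice.  So the level-resolved clause with `B = A_κG₀/(1−ρ′)` follows from tree decay in the separation at each
gap TOGETHER WITH a per-gap decay `ν`; neither alone. [folklore] -/
theorem sliceSum_le_of_treeDecay {s : Finset ι} (lvl : ι → ℕ) (dist : ι → ι → ℕ) (κ : ι → ι → ℝ)
    {Aκ G₀ Γ θ ρ' Λ ν : ℝ} {D : ℕ} (p : ι) (g : ℕ) (hAκ : 0 ≤ Aκ) (hG₀ : 0 ≤ G₀) (hΓ : 0 ≤ Γ) (hθ : 0 ≤ θ)
    (hΛ : 0 ≤ Λ) (hν : 0 ≤ ν)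
    (hκ : ∀ q ∈ s, lvl q + g = lvl p → κ p q ≤ Aκ * ν ^ g * θ ^ dist p q)
    (hD : ∀ q ∈ s, lvl q + g = lvl p → dist p q ≤ D)
    (hG : ∀ n, n ≤ D →
      ((((s.filter fun q => lvl q + g = lvl p).filter fun q => dist p q = n).card : ℝ)) ≤ G₀ * Λ ^ g * Γ ^ n)
    (hρ : Γ * θ ≤ ρ') (hρ1 : ρ' < 1) :
    ∑ q ∈ s.filter (fun q => lvl q + g = lvl p), κ p q ≤ (Aκ * G₀ / (1 - ρ')) * (Λ * ν) ^ g := by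
  have h := rowSum_le_of_treeDecay (s := s.filter fun q => lvl q + g = lvl p) dist κ (A := Aκ * ν ^ g)
    (G₀ := G₀ * Λ ^ g) p (mul_nonneg hAκ (pow_nonneg hν g)) (mul_nonneg hG₀ (pow_nonneg hΛ g)) hΓ hθ
    (fun q hq => by
      obtain ⟨hqs, hqg⟩ := mem_filter.mp hq
      exact hκ q hqs hqg)
    (fun q hq => by
      obtain ⟨hqs, hqg⟩ := mem_filter.mp hq
      exact hD q hqs hqg)
    hG hρ hρ1
  calc ∑ q ∈ s.filter (fun q => lvl q + g = lvl p), κ p q ≤ Aκ * ν ^ g * (G₀ * Λ ^ g / (1 - ρ')) := h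
    _ = (Aκ * G₀ / (1 - ρ')) * (Λ * ν) ^ g := by rw [mul_pow]; ring

end Suppliers

/-! ## §3 (K13e–h) The hypothesis shape and its measure-side consequences -/

section Shape

variable {Ω : Type*} [MeasurableSpace Ω] {ι : Type*} {μ : Measure Ω} {s : Finset ι} {X : ι → Ω → ℝ} {σ : ι → ℝ}
  {κ : ι → ι → ℝ} {lvl : ι → ℕ} {B Λ ν C : ℝ}

/-- **(K13e) HYPOTHESIS SHAPE `TowerDecorrelation μ s X σ κ lvl B Λ ν`** — the LEVEL-RESOLVED cross-pair decorrelation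
clause (GAPS G-pv18g6-1 (i) typed).  DATA as `T4PairDecorrelation.PairDecorrelation` (K12c) plus a birth-level map `lvl`
and the three numbers `B` (same-gap row budget), `Λ` (partner growth per level of gap; cell `L⁴`), `ν` (correlation decay
per level of gap).  CLAUSES: `σ ≥ 0`, `κ ≥ 0` on `s`; COVARIANCE DOMINATION `|∫X_pX_q dμ| ≤ κ(p,q)σ_pσ_q`; and for every
piece `p ∈ s` and every gap `g`, the kernel mass of `p` on the pieces born `g` levels BELOW it — for `κ` (`down_le`) and for
the transposed kernel (`downT_le`) — is `≤ B·(Λν)^g`.  CONSEQUENCE (K13g): `∫(Σ_p c_pX_p)² dμ ≤ 2N₀AB/((1−ρ)(1−r))` along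
the variance line.  CALIBRATION: the level-blind shape (K12c) with budget `C` is the case `(B, ν) = (C, Λ⁻¹)` (K13f); §4
says which `ν` the variance line affords (`Λντ < 1`).  Nothing of it is asserted: this is a HYPOTHESIS SHAPE. [folklore] -/
structure TowerDecorrelation (μ : Measure Ω) (s : Finset ι) (X : ι → Ω → ℝ) (σ : ι → ℝ) (κ : ι → ι → ℝ)
    (lvl : ι → ℕ) (B Λ ν : ℝ) : Prop where
  σ_nonneg : ∀ p ∈ s, 0 ≤ σ p
  κ_nonneg : ∀ p ∈ s, ∀ q ∈ s, 0 ≤ κ p q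
  cov_le : ∀ p ∈ s, ∀ q ∈ s, |∫ ω, X p ω * X q ω ∂μ| ≤ κ p q * (σ p * σ q)
  down_le : ∀ p ∈ s, ∀ g : ℕ, ∑ q ∈ s.filter (fun q => lvl q + g = lvl p), κ p q ≤ B * (Λ * ν) ^ g
  downT_le : ∀ p ∈ s, ∀ g : ℕ, ∑ q ∈ s.filter (fun q => lvl q + g = lvl p), κ q p ≤ B * (Λ * ν) ^ g

namespace TowerDecorrelation

/-- (K13e′) For a SYMMETRIC kernel the transposed clause is the clause. [folklore] -/
theorem of_symm (hσ : ∀ p ∈ s, 0 ≤ σ p) (hκ : ∀ p ∈ s, ∀ q ∈ s, 0 ≤ κ p q)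
    (hsymm : ∀ p ∈ s, ∀ q ∈ s, κ p q = κ q p)
    (hcov : ∀ p ∈ s, ∀ q ∈ s, |∫ ω, X p ω * X q ω ∂μ| ≤ κ p q * (σ p * σ q))
    (hdown : ∀ p ∈ s, ∀ g : ℕ, ∑ q ∈ s.filter (fun q => lvl q + g = lvl p), κ p q ≤ B * (Λ * ν) ^ g) :
    TowerDecorrelation μ s X σ κ lvl B Λ ν where
  σ_nonneg := hσ
  κ_nonneg := hκ
  cov_le := hcov
  down_le := hdown
  downT_le := fun p hp g => by
    rw [sum_congr rfl fun q hq => (hsymm p hp q (mem_filter.mp hq).1).symm]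
    exact hdown p hp g

/-- (K13e″) The same-gap budget is nonnegative as soon as there is a piece (slice `g = 0` at that piece). [folklore] -/
theorem budget_nonneg (h : TowerDecorrelation μ s X σ κ lvl B Λ ν) (hs : s.Nonempty) : 0 ≤ B := by
  obtain ⟨p, hp⟩ := hs
  have h0 := h.down_le p hp 0
  rw [pow_zero, mul_one] at h0
  exact (sum_nonneg fun q hq => h.κ_nonneg p hp q (mem_filter.mp hq).1).trans h0

/-- **(K13f) THE LEVEL-BLIND CLAUSE IS THE CORNER `ν = Λ⁻¹`** (K5 ⊂ K6): a `PairDecorrelation μ s X σ κ C` (row and column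
sums `≤ C`) is a `TowerDecorrelation` with `B = C`, `ν = Λ⁻¹` for ANY level map and any `Λ > 0` — each slice is part of a
row (resp. column) and `(Λ·Λ⁻¹)^g = 1`.  The levelled clause then asks `Λντ = τ ≤ ρ < 1`, nothing else. [folklore] -/
theorem of_pairDecorrelation (h : PairDecorrelation μ s X σ κ C) (lvl : ι → ℕ) {Λ : ℝ} (hΛ : 0 < Λ) :
    TowerDecorrelation μ s X σ κ lvl C Λ Λ⁻¹ where
  σ_nonneg := h.σ_nonneg
  κ_nonneg := h.κ_nonneg
  cov_le := h.cov_le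
  down_le := fun p hp g => by
    rw [mul_inv_cancel₀ hΛ.ne', one_pow, mul_one]
    exact (sum_le_sum_of_subset_of_nonneg (filter_subset _ s) fun q hq _ => h.κ_nonneg p hp q hq).trans
      (h.row_le p hp)
  downT_le := fun p hp g => by
    rw [mul_inv_cancel₀ hΛ.ne', one_pow, mul_one]
    exact (sum_le_sum_of_subset_of_nonneg (filter_subset _ s) fun q hq _ => h.κ_nonneg q hq p hp).trans
      (h.col_le p hp)

/-- (K13g₀) Termwise covariance domination under amplitudes: `|M(p,q)| ≤ κ(p,q)σ_pσ_q` with `σ ≥ 0` gives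
`Σ_{p,q} c_pc_qM(p,q) ≤ Σ_{p,q} κ(p,q)|c_pσ_p||c_qσ_q|`. [folklore] -/
theorem sum_mul_mul_le_sum_kernel (s : Finset ι) (M κ : ι → ι → ℝ) (c σ : ι → ℝ) (hσ : ∀ p ∈ s, 0 ≤ σ p)
    (hM : ∀ p ∈ s, ∀ q ∈ s, |M p q| ≤ κ p q * (σ p * σ q)) :
    ∑ p ∈ s, ∑ q ∈ s, c p * c q * M p q ≤ ∑ p ∈ s, ∑ q ∈ s, κ p q * (|c p * σ p| * |c q * σ q|) :=
  sum_le_sum fun p hp => sum_le_sum fun q hq => by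
    calc c p * c q * M p q ≤ |c p * c q * M p q| := le_abs_self _
      _ = |c p| * |c q| * |M p q| := by rw [abs_mul, abs_mul]
      _ ≤ |c p| * |c q| * (κ p q * (σ p * σ q)) :=
          mul_le_mul_of_nonneg_left (hM p hp q hq) (mul_nonneg (abs_nonneg _) (abs_nonneg _))
      _ = κ p q * (|c p * σ p| * |c q * σ q|) := by
          rw [abs_mul (c p), abs_mul (c q), abs_of_nonneg (hσ p hp), abs_of_nonneg (hσ q hq)]
          ring

/-- **(K13g) THE SECOND MOMENT OF THE CUBE-FAMILY ON THE VARIANCE LINE, LEVEL-RESOLVED.**  Under the shape, with birth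
levels `lvl p ≤ k ≤ K`, squared per-piece budgets `(c_pσ_p)² ≤ A(τ²)^{K − lvl p}`, positional counts
`#{p : lvl p = j} ≤ N₀Λ^{k−j}`, `0 ≤ τ ≤ 1`, `Λτ² ≤ r < 1` and `Λντ ≤ ρ < 1`:
`∫(Σ_p c_pX_p)² dμ ≤ 2·N₀·(AB/(1−ρ))/(1−r)` — K-UNIFORM.  Integrability of the products is the honest binder (automatic for
bounded strongly measurable pieces on a finite measure, `T4PairDecorrelation.integrable_mul_of_abs_le`). [folklore] -/
theorem integral_sq_sum_le_line (h : TowerDecorrelation μ s X σ κ lvl B Λ ν)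
    (hint : ∀ p ∈ s, ∀ q ∈ s, Integrable (fun ω => X p ω * X q ω) μ) (c : ι → ℝ)
    {N₀ A τ r ρ : ℝ} {K k : ℕ} (hk : k ≤ K) (hlvl : ∀ p ∈ s, lvl p ≤ k)
    (hcard : ∀ j, j ≤ k → ((s.filter fun p => lvl p = j).card : ℝ) ≤ N₀ * Λ ^ (k - j))
    (hN₀ : 0 ≤ N₀) (hA : 0 ≤ A) (hB : 0 ≤ B) (hΛ : 0 ≤ Λ) (hν : 0 ≤ ν) (hτ0 : 0 ≤ τ) (hτ1 : τ ≤ 1)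
    (hr : Λ * τ ^ 2 ≤ r) (hr1 : r < 1) (hρ : Λ * ν * τ ≤ ρ) (hρ1 : ρ < 1)
    (hw : ∀ p ∈ s, (c p * σ p) ^ 2 ≤ A * (τ ^ 2) ^ (K - lvl p)) :
    ∫ ω, (∑ p ∈ s, c p * X p ω) ^ 2 ∂μ ≤ 2 * (N₀ * (A * (B / (1 - ρ))) / (1 - r)) := by
  have hexp : ∀ ω, (∑ p ∈ s, c p * X p ω) ^ 2 = ∑ p ∈ s, ∑ q ∈ s, c p * c q * (X p ω * X q ω) :=
    fun ω => by
      rw [sq, sum_mul_sum]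
      exact sum_congr rfl fun p _ => sum_congr rfl fun q _ => by ring
  have hI : ∫ ω, (∑ p ∈ s, c p * X p ω) ^ 2 ∂μ = ∑ p ∈ s, ∑ q ∈ s, c p * c q * ∫ ω, X p ω * X q ω ∂μ := by
    simp_rw [hexp]
    rw [integral_finsetSum _ fun p hp => integrable_finsetSum _ fun q hq => (hint p hp q hq).const_mul _]
    refine sum_congr rfl fun p hp => ?_
    rw [integral_finsetSum _ fun q hq => (hint p hp q hq).const_mul _]
    exact sum_congr rfl fun q _ => integral_const_mul _ _
  rw [hI]
  exact (sum_mul_mul_le_sum_kernel s (fun p q => ∫ ω, X p ω * X q ω ∂μ) κ c σ h.σ_nonneg h.cov_le).trans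
    (levelledSum_le_of_sq lvl κ (fun p => c p * σ p) hk hlvl hcard hN₀ hA hB hΛ hν hτ0 hτ1 hr hr1 hρ hρ1
      h.κ_nonneg h.down_le h.downT_le hw)

/-- **(K13h) HEADLINE — THE CUBE-FAMILY MOVES THE EFFECTIVE ACTION ALONG THE VARIANCE LINE, LEVEL-RESOLVED.**  For a
probability law `μ`, bounded strongly measurable CENTRED pieces (`|X_p| ≤ b_p`, `∫X_p dμ = 0` on `s`), amplitudes with
`Σ_p |c_p|b_p ≤ 1`, and the data of (K13g): `0 ≤ log∫exp(−Σ_p c_pX_p) dμ ≤ 2·N₀·(AB/(1−ρ))/(1−r)` — K-UNIFORM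
(`T4CoReadMoment.log_integral_exp_neg_nonneg` / `_le_sq` (K10) BY NAME + (K13g)).  With `(B, ν) = (C_dec, Λ⁻¹)` this is
K5's headline (K12g′) up to `2/(1−τ)`; its new content is every `ν` with `Λντ < 1`. [folklore] -/
theorem log_integral_exp_neg_sum_le_line [IsProbabilityMeasure μ] (h : TowerDecorrelation μ s X σ κ lvl B Λ ν)
    (hXm : ∀ p ∈ s, AEStronglyMeasurable (X p) μ) {b : ι → ℝ} (hXb : ∀ p ∈ s, ∀ ω, |X p ω| ≤ b p)
    (hX0 : ∀ p ∈ s, ∫ ω, X p ω ∂μ = 0) {c : ι → ℝ} (hc : ∑ p ∈ s, |c p| * b p ≤ 1)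
    {N₀ A τ r ρ : ℝ} {K k : ℕ} (hk : k ≤ K) (hlvl : ∀ p ∈ s, lvl p ≤ k)
    (hcard : ∀ j, j ≤ k → ((s.filter fun p => lvl p = j).card : ℝ) ≤ N₀ * Λ ^ (k - j))
    (hN₀ : 0 ≤ N₀) (hA : 0 ≤ A) (hB : 0 ≤ B) (hΛ : 0 ≤ Λ) (hν : 0 ≤ ν) (hτ0 : 0 ≤ τ) (hτ1 : τ ≤ 1)
    (hr : Λ * τ ^ 2 ≤ r) (hr1 : r < 1) (hρ : Λ * ν * τ ≤ ρ) (hρ1 : ρ < 1)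
    (hw : ∀ p ∈ s, (c p * σ p) ^ 2 ≤ A * (τ ^ 2) ^ (K - lvl p)) :
    0 ≤ Real.log (∫ ω, Real.exp (-∑ p ∈ s, c p * X p ω) ∂μ) ∧
      Real.log (∫ ω, Real.exp (-∑ p ∈ s, c p * X p ω) ∂μ) ≤ 2 * (N₀ * (A * (B / (1 - ρ))) / (1 - r)) := by
  have hVm : AEStronglyMeasurable (fun ω => ∑ p ∈ s, c p * X p ω) μ :=
    Finset.aestronglyMeasurable_fun_sum s fun p hp => (hXm p hp).const_mul (c p)
  have hVb : ∀ ω, |∑ p ∈ s, c p * X p ω| ≤ 1 := fun ω =>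
    (abs_sum_le_sum_abs _ _).trans ((sum_le_sum fun p hp => by
      rw [abs_mul]
      exact mul_le_mul_of_nonneg_left (hXb p hp ω) (abs_nonneg _)).trans hc)
  have hV0 : ∫ ω, ∑ p ∈ s, c p * X p ω ∂μ = 0 := by
    rw [integral_finsetSum _ fun p hp => (integrable_of_abs_le (hXm p hp) (hXb p hp)).const_mul (c p)]
    exact sum_eq_zero fun p hp => by rw [integral_const_mul, hX0 p hp, mul_zero]
  exact ⟨log_integral_exp_neg_nonneg hVm hVb hV0,
    (log_integral_exp_neg_le_sq hVm hVb hV0).trans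
      (h.integral_sq_sum_le_line (fun p hp q hq => integrable_mul_of_abs_le hXm hXb hp hq) c hk hlvl hcard hN₀ hA
        hB hΛ hν hτ0 hτ1 hr hr1 hρ hρ1 hw)⟩

end TowerDecorrelation

end Shape

/-! ## §4 (K13i–l) Calibration: which per-gap decay `ν` the variance line affords -/

section Calibration

/-- (K13i₀) THE ATTAINED LINE OF THE TREE MODEL.  `towerLine N₀ M B Λ ν τ K k` = Σ over birth levels `i ≤ k` and gaps
`g ≤ k − i` of (count `N₀Λ^{k−i}` of level-`i` pieces) × (upward slice budget `Bν^g`: a bounded number of pieces above at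
each gap, folded into `B`, each correlated `ν^g`) × (amplitudes `Mτ^{K−i}·Mτ^{K−(i+g)}`).  It is the `lvl q > lvl p` half
of the double sum of (K13b) for the Λ-ary tree model (one piece per node of a depth-`k` tree with `Λ` children per node,
`κ = ν^{gap}` on nested pairs and `0` otherwise, amplitudes EQUAL to the profile) — the configuration in which every
inequality of (K13a) is an equality. [folklore] -/
def towerLine (N₀ M B Λ ν τ : ℝ) (K k : ℕ) : ℝ :=
  ∑ i ∈ range (k + 1), ∑ g ∈ range (k - i + 1),
    (N₀ * Λ ^ (k - i)) * (B * ν ^ g) * ((M * τ ^ (K - i)) * (M * τ ^ (K - (i + g))))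

/-- **(K13i) O(1) CO-TOWER CORRELATIONS ARE NOT AFFORDABLE.**  With NO decay per level of gap (`ν = 1`: a piece is
O(1)-correlated with every piece nested in it) and `Λτ ≥ 1` (cell values `Λτ = L⁴·L⁻³ = L`), the attained line of a cube of
level `k ≤ K` is `≥ (k+1)·N₀M²B·τ^{2(K−k)}`: at each birth level `i` the single gap `g = k − i` (correlation with the TOP
piece) already contributes `N₀M²Bτ^{2(K−k)}(Λτ)^{k−i} ≥ N₀M²Bτ^{2(K−k)}` — `T4CoReadMoment.supLine_ge`'s divergence one
level up. [folklore] -/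
theorem towerLine_ge {N₀ M B Λ τ : ℝ} {K k : ℕ} (hk : k ≤ K) (hN₀ : 0 ≤ N₀) (hB : 0 ≤ B) (hΛ : 0 ≤ Λ)
    (hτ0 : 0 ≤ τ) (hΛτ : 1 ≤ Λ * τ) :
    (k + 1 : ℝ) * (N₀ * M ^ 2 * B * (τ ^ (K - k)) ^ 2) ≤ towerLine N₀ M B Λ 1 τ K k := by
  unfold towerLine
  have hterm : ∀ i ∈ range (k + 1), N₀ * M ^ 2 * B * (τ ^ (K - k)) ^ 2 ≤
      ∑ g ∈ range (k - i + 1),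
        (N₀ * Λ ^ (k - i)) * (B * (1 : ℝ) ^ g) * ((M * τ ^ (K - i)) * (M * τ ^ (K - (i + g)))) := by
    intro i hi
    have hi' : i ≤ k := Nat.lt_succ_iff.mp (mem_range.mp hi)
    have hnn : ∀ g ∈ range (k - i + 1),
        0 ≤ (N₀ * Λ ^ (k - i)) * (B * (1 : ℝ) ^ g) * ((M * τ ^ (K - i)) * (M * τ ^ (K - (i + g)))) := by
      intro g _
      have : (M * τ ^ (K - i)) * (M * τ ^ (K - (i + g))) = M ^ 2 * (τ ^ (K - i) * τ ^ (K - (i + g))) := by ring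
      rw [this]
      exact mul_nonneg (mul_nonneg (mul_nonneg hN₀ (pow_nonneg hΛ _)) (mul_nonneg hB (by rw [one_pow]; exact zero_le_one)))
        (mul_nonneg (sq_nonneg M) (mul_nonneg (pow_nonneg hτ0 _) (pow_nonneg hτ0 _)))
    have hmem : k - i ∈ range (k - i + 1) := mem_range.mpr (Nat.lt_succ_self _)
    refine le_trans ?_ (single_le_sum hnn hmem)
    have e1 : K - i = (K - k) + (k - i) := by omega
    have e2 : K - (i + (k - i)) = K - k := by omega
    rw [one_pow, mul_one, e2, e1, pow_add]
    have h1 : (1 : ℝ) ≤ (Λ * τ) ^ (k - i) := one_le_pow₀ hΛτ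
    calc N₀ * M ^ 2 * B * (τ ^ (K - k)) ^ 2 = (N₀ * M ^ 2 * B * (τ ^ (K - k)) ^ 2) * 1 := by ring
      _ ≤ (N₀ * M ^ 2 * B * (τ ^ (K - k)) ^ 2) * (Λ * τ) ^ (k - i) :=
          mul_le_mul_of_nonneg_left h1
            (mul_nonneg (mul_nonneg (mul_nonneg hN₀ (sq_nonneg M)) hB) (sq_nonneg _))
      _ = (N₀ * Λ ^ (k - i)) * B * ((M * (τ ^ (K - k) * τ ^ (k - i))) * (M * τ ^ (K - k))) := by
          rw [mul_pow]; ring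
  have := Finset.card_nsmul_le_sum (range (k + 1)) _ _ hterm
  simpa [card_range, nsmul_eq_mul] using this

/-- **(K13i′) AT THE TOP CUBE `k = K`**: with `ν = 1` and `Λτ ≥ 1` the attained line is `≥ (K+1)·N₀M²B` — UNBOUNDED in the
number of levels.  So «κ(p,q) = O(1) for tower-sharing p, q» read literally (no decay in the gap) is NOT affordable by the
variance line at the cell's values; some per-gap decay is NECESSARY for this booking. [folklore] -/
theorem towerLine_top_ge {N₀ M B Λ τ : ℝ} (K : ℕ) (hN₀ : 0 ≤ N₀) (hB : 0 ≤ B) (hΛ : 0 ≤ Λ) (hτ0 : 0 ≤ τ)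
    (hΛτ : 1 ≤ Λ * τ) : (K + 1 : ℝ) * (N₀ * M ^ 2 * B) ≤ towerLine N₀ M B Λ 1 τ K K := by
  simpa using towerLine_ge (K := K) (k := K) (M := M) le_rfl hN₀ hB hΛ hτ0 hΛτ

/-- **(K13j) THE THRESHOLD.**  For `Λ, τ > 0`: `Λντ < 1 ↔ ν < 1/(Λτ)` — the per-gap correlation decay the variance line
affords is exactly `ν < 1/(Λθ₁)`; cell values `Λ = L⁴`, `θ₁ = L⁻³`: `ν < L⁻¹`. [folklore] -/
theorem threshold_iff {Λ ν τ : ℝ} (hΛ : 0 < Λ) (hτ : 0 < τ) : Λ * ν * τ < 1 ↔ ν < 1 / (Λ * τ) := by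
  rw [lt_div_iff₀ (mul_pos hΛ hτ)]
  constructor <;> intro h <;> linarith [mul_comm (Λ * ν) τ, mul_assoc Λ ν τ, mul_comm ν (Λ * τ), mul_assoc Λ τ ν,
    mul_comm τ ν]

/-- **(K13k) THE CLT-SIZE DECAY NEEDS NOTHING NEW.**  For `Λ, τ ≥ 0`: `√Λ·τ < 1 ↔ Λτ² < 1` — with `ν = Λ^{−1/2}` (so that
`Λν = √Λ`) the gap product `Λντ = √Λ·τ` is `< 1` exactly when the variance line's own product `Λτ²` is. [folklore] -/
theorem sqrt_mul_lt_one_iff {Λ τ : ℝ} (hΛ : 0 ≤ Λ) (hτ : 0 ≤ τ) : Real.sqrt Λ * τ < 1 ↔ Λ * τ ^ 2 < 1 := by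
  have h0 : 0 ≤ Real.sqrt Λ * τ := mul_nonneg (Real.sqrt_nonneg Λ) hτ
  have hsq : (Real.sqrt Λ * τ) ^ 2 = Λ * τ ^ 2 := by rw [mul_pow, Real.sq_sqrt hΛ]
  rw [← hsq]
  exact (sq_lt_one_iff₀ h0).symm

/-- (K13k′) … and `√Λ·Λ^{−1/2}`-bookkeeping: for `Λ > 0`, `Λ·(√Λ)⁻¹ = √Λ`. [folklore] -/
theorem mul_inv_sqrt_eq {Λ : ℝ} (hΛ : 0 < Λ) : Λ * (Real.sqrt Λ)⁻¹ = Real.sqrt Λ := by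
  have hs : 0 < Real.sqrt Λ := Real.sqrt_pos.mpr hΛ
  field_simp
  rw [Real.sq_sqrt hΛ.le]

/-- **(K13l) NUMERIC INSTANCE `L = 2`**: `Λ = 16`, `τ = θ₁ = 1/8`.  `ν = 1` (O(1) co-tower correlations): `Λντ = 2 ≥ 1`
— FAILS; `ν = Λ^{−1/2} = 1/4 = L⁻²` (CLT-size): `Λντ = 1/2 < 1` — passes; `ν = Λ⁻¹ = 1/16` (the level-blind corner K13f):
`Λντ = 1/8 < 1` — passes; threshold `1/(Λτ) = 1/2 = L⁻¹`. [arith] [folklore] -/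
theorem cellValues_L2_tower :
    (1 : ℝ) ≤ 16 * 1 * (1 / 8) ∧ (16 : ℝ) * (1 / 4) * (1 / 8) < 1 ∧ (16 : ℝ) * (1 / 16) * (1 / 8) < 1 ∧
      (1 : ℝ) / (16 * (1 / 8)) = 1 / 2 := by
  norm_num

/-- The same at `L = 3`: `Λ = 81`, `τ = 1/27`: `ν = 1` gives `3 ≥ 1` (fails), `ν = 1/9 = L⁻²` gives `1/3 < 1` (passes),
threshold `1/(Λτ) = 1/3 = L⁻¹`. [arith] [folklore] -/
theorem cellValues_L3_tower :
    (1 : ℝ) ≤ 81 * 1 * (1 / 27) ∧ (81 : ℝ) * (1 / 9) * (1 / 27) < 1 ∧ (1 : ℝ) / (81 * (1 / 27)) = 1 / 3 := by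
  norm_num

/-- **(K13l′) GENERAL `L > 1`**: with `Λ = L⁴`, `τ = L⁻³`: the O(1) product `Λ·1·τ = L ≥ 1` (fails), the CLT product
`Λ·L⁻²·τ = L⁻¹ < 1` (passes), the variance product `Λτ² = L⁻² < 1`, and the threshold `1/(Λτ) = L⁻¹`. [arith] [folklore] -/
theorem cellValues_tower {L : ℝ} (hL : 1 < L) :
    (1 : ℝ) ≤ L ^ 4 * 1 * (L ^ 3)⁻¹ ∧ L ^ 4 * (L ^ 2)⁻¹ * (L ^ 3)⁻¹ < 1 ∧ L ^ 4 * ((L ^ 3)⁻¹) ^ 2 < 1 ∧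
      1 / (L ^ 4 * (L ^ 3)⁻¹) = L⁻¹ := by
  have hL0 : 0 < L := by linarith
  have hL0' : L ≠ 0 := hL0.ne'
  have e1 : L ^ 4 * 1 * (L ^ 3)⁻¹ = L := by field_simp
  have e2 : L ^ 4 * (L ^ 2)⁻¹ * (L ^ 3)⁻¹ = L⁻¹ := by field_simp
  have e3 : L ^ 4 * ((L ^ 3)⁻¹) ^ 2 = (L ^ 2)⁻¹ := by field_simp
  have e4 : 1 / (L ^ 4 * (L ^ 3)⁻¹) = L⁻¹ := by field_simp
  refine ⟨by rw [e1]; exact hL.le, by rw [e2]; exact inv_lt_one_of_one_lt₀ hL, ?_, e4⟩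
  rw [e3]
  exact inv_lt_one_of_one_lt₀ (by nlinarith)

end Calibration

end Literature.MathematicalPhysics.QuantumFieldTheory.Balaban1983to89.T4TowerDecorrelation

end
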